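import Summits.ResolutionOfSingularities.ResolutionOfSingularities.Theorems.WeightedInvariantLocalWeightedDropNCGameTransport
import Summits.ResolutionOfSingularities.ResolutionOfSingularities.Theorems.WeightedInvariantLocalWeightedDropMonomialCloudStep

/-!
# TOT rung R6 (TORIC / NEWTON NON-DEGENERATE) for `NCTransport.HTOT m` — typed statement, the COMBINATORIAL HALF PROVED from the
# tree's cloud potential, the two analytic lemmas typed, and the assembly PROVED
# (strategist res-L1-w43-strat-1, gen 4 v2; crux item stmt-ResolutionOfSingularities-8899 `WeightedInvariant.LocalWeightedDrop`)

[OURS · sketch; NO `sorry`; offered to res-D-pv-006 / plan-1 as the next rung after R0 (p510594) and beside R2 (res-type-088).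
Nothing here is a statement of any manuscript; literature inputs are cited by page in TOT-RUNGS-SPEC v3 §R6.]

THE RUNG.  `TOTRungNonDegenerate m`: every non-zero germ `b ∈ k⟦x₀,…,x_m⟧` that is NEWTON NON-DEGENERATE ON COMPACT FACES in the
logarithmic-Jacobian sense (`NewtonNonDegenerate`: for every positive weight `w`, the `w`-initial form `g = in_w b` together with its
Euler derivatives `xᵢ∂ᵢg` generates an ideal of `k⟦x⟧` containing a power of `x₀⋯x_m`) is won by the mover of the count game in
finitely many rounds: `∃ n, TameFourTupleDrop.WinsIn GermIsNC n b`.  Char-free, every dimension; incomparable with R2 (arrangements)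
and R5 (products); contains R0 and the tame binomials `x^μ(x^α − λx^β)`, `p ∤ (α − β)`; correctly EXCLUDES the wild binomial
`x₀^p − u·x_j^p` and Narasimhan's `x² + yz³ + zw³ + y⁷w` (p = 2; degenerate on the face of weight `(32,7,19,15)`).

STRUCTURE OF THE PROOF (v2 — after finding that the tree ALREADY holds Hironaka's polyhedra game WITH TRANSLATED ANSWERS):
(a) COMBINATORIAL HALF = the cloud potential of `…LocalWeightedDropMonomialCloudStep` (res-D-pv-006 for (B3)): a move with centre `J`,
    live slot `l`, translated slots `Z ⊆ J ∖ {l}` sends every exponent ROW-vector `e` to `MonomialCloud.succ J l Z 0 e` (sum over `J`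
    into the slot `l`, zero on `Z`), and `MonomialCloud.mu_succ_lt_of_incPairs` (Perron's pair step, arXiv:1907.02094 Prop. 2.2 =
    Spivakovsky 1983) lowers `mu < ω³` at EVERY successor while the cloud has an incomparable pair.  PROVED HERE: `CloudGame.CloudWins`
    (finite-depth winnability of the cloud game, permutations of the slots allowed) and `CloudGame.exists_cloudWins` — a UNIFORM round
    bound, by well-founded induction on `mu` and a `Finset.sup` over the finitely many `(l, Z, σ)`.
(b) TORIC STATE (`ToricState b B`, typed): the current position `B` is `v · X^c · h` and the total transform of the ORIGINAL germ under
    `xᵢ = X^{cols·i} · uᵢ` (units `uᵢ`; toric slots `T`, log slots = the translated ones) is `X^d · h`, with every column of `cols`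
    non-zero and the LOG-JACOBIAN MATRIX `[cols_t (t ∈ T) ; ∂_t log uᵢ(0) (t ∉ T)]` invertible over `k`.  `ToricStep m` (statement): the
    move `Φ = X`, `w = 𝟙_J` (`J ⊆ T`) satisfies the game's `MoveClause` with goodness «admits a toric state whose cloud is
    `succ J l Z 0 ∘ σ` of the old one» — chart calculus `subst_chart_unitMonomial` / `factor_eq` / `slice_ne_zero` (tree) plus the row
    reduction `row_s = Σ_{j∈J} row_j`, `row_j / c_j ↦ log block (j ∈ Z)`, old log rows unchanged (the new origin maps to the old one).
(c) `ToricEnd m` (statement): at a CHAIN state (no incomparable pair) the position is NC, given `NewtonNonDegenerate b`: the least cloud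
    vector `e_{a₀}` is `≤ e_β` for all `β ∈ supp b` (`Covers`), the face `{β : e_β = e_{a₀}}` is `supp (in_W b)` for the positive weight
    `W = Σ_{t∈T} cols_t`, `coeff_{X^{e_{a₀}}} (b∘x) = in_W b (ū)` at the torus point `ū = u(0)`; if it vanishes, `TorusSmooth` — read
    through the substitution `Xᵢ ↦ ūᵢ·t^{Wᵢ}` into `k⟦t⟧` — gives `v = (Σ_β b_β βᵢ ū^β)ᵢ ≠ 0`, killed by the toric rows, hence some LOG
    slot `t` has `coeff_{X^{e_{a₀}}·X_t} (b∘x) ≠ 0`; coefficient comparison `X^d h = X^{e_{a₀}} q` gives `h = X^{e_{a₀} − d} q` and the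
    landed recognition lemmas `germIsNC_of_unitMonomial` / `germIsNC_of_smooth_mul_unitMonomial` (p510594) finish.  (= Ishii 1997
    Lemma 4.4.24's computation, inside the game.)
(d) ASSEMBLY PROVED HERE: `totRungNonDegenerate_of_toric : ToricStep m → ToricEnd m → TOTRungNonDegenerate m` (minimal exponents by
    Dickson = `WellQuasiOrderedLE.finite_of_isAntichain`; initial state `ToricState.init`; induction on `CloudWins`).
(e) `WinsIn GermIsNC n` is invariant under legal coordinate changes (`SpaceCountGameInvariance.winsIn_germIsNC_of_subst`), whence the
    coordinate-free corollary `TOTRungNonDegenerateFree`.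
-/

set_option linter.dupNamespace false -- mandated namespace of this single-conjunct summit

namespace Summit.ResolutionOfSingularities.ResolutionOfSingularities.Theorems

namespace NCTransport

open MvPowerSeries Literature.AlgebraicGeometry.Resolution TameFourTupleDrop

variable {k : Type} [Field k]

/-! ## Newton non-degeneracy in logarithmic-Jacobian form (compact faces) -/

/-- The EULER OPERATOR `xᵢ∂ᵢ`, coefficientwise: `(xᵢ∂ᵢ b)_α = αᵢ · b_α` (char-free; no division). -/
noncomputable def eulerOp {n : ℕ} (i : Fin n) (b : MvPowerSeries (Fin n) k) : MvPowerSeries (Fin n) k :=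
  fun α => ((α i : ℕ) : k) * coeff α b

/-- The `w`-INITIAL FORM of `b`: its terms of least `w`-weight (`0` for `b = 0`).  For a positive weight `w` this is the face
polynomial `b_F` of the compact face `F = F(w)` of the Newton polyhedron `Γ₊(b) = conv(supp b) + ℝ₊^{n}` (finite support), and every
compact face arises this way. -/
noncomputable def initForm {n : ℕ} (w : Fin n → ℕ) (b : MvPowerSeries (Fin n) k) : MvPowerSeries (Fin n) k :=
  fun α => if ((Finsupp.weight w α : ℕ) : ℕ∞) = weightedOrder w b then coeff α b else 0

/-- `g = 0` HAS NO SINGULAR POINT ON THE TORUS (near the origin), logarithmic Jacobian criterion: some power of `x₀⋯x_{n-1}` lies in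
the ideal `(g, x₀∂₀g, …, x_{n-1}∂_{n-1}g)` of `k⟦x⟧`.  For a quasi-homogeneous `g` with positive weights this is membership in
`k[x]` (take the weighted-homogeneous component) and, over `k = k̄`, says that `g` and its Euler derivatives have no common zero on
`(k^×)^n` — Ishii 1997 Def. 4.4.22 with `g` adjoined (weaker hypothesis, same Lemma 4.4.24). -/
def TorusSmooth {n : ℕ} (g : MvPowerSeries (Fin n) k) : Prop :=
  ∃ N : ℕ, (∏ i, X i) ^ N ∈ Ideal.span (insert g (Set.range fun i => eulerOp i g))

/-- NEWTON NON-DEGENERACY ON COMPACT FACES: every initial form for a positive weight is torus-smooth. -/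
def NewtonNonDegenerate {n : ℕ} (b : MvPowerSeries (Fin n) k) : Prop :=
  ∀ w : Fin n → ℕ, (∀ i, 0 < w i) → TorusSmooth (initForm w b)

/-- TOT RUNG R6 in `m + 1` variables: every non-zero Newton non-degenerate germ is won by the mover of the count game within finitely
many rounds (terminal predicate `GermIsNC`).  A sorry-free proof is an `HTOT m`-instance on the class of non-degenerate germs. -/
def TOTRungNonDegenerate (m : ℕ) : Prop :=
  ∀ (p : ℕ), p.Prime → ∀ (k : Type) [Field k] [CharP k p] [IsAlgClosed k],
    ∀ b : MvPowerSeries (Fin (m + 1)) k, b ≠ 0 → NewtonNonDegenerate b → ∃ n, WinsIn (m := m) GermIsNC n b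

/-- Coordinate-free corollary (via (e)): non-degenerate after SOME legal formal coordinate change `Φ` (zero constant terms,
invertible linear part) suffices.  Contains R0 (`u · x^e · g`, `g` smooth transversal) and every germ `(x+y)(z+w)`-like that a linear
change makes toric. -/
def TOTRungNonDegenerateFree (m : ℕ) : Prop :=
  ∀ (p : ℕ), p.Prime → ∀ (k : Type) [Field k] [CharP k p] [IsAlgClosed k],
    ∀ b : MvPowerSeries (Fin (m + 1)) k, b ≠ 0 →
      (∃ Φ : Fin (m + 1) → MvPowerSeries (Fin (m + 1)) k,
        (∀ i, constantCoeff (Φ i) = 0) ∧ IsUnit (Matrix.det (Matrix.of fun i j => coeff (Finsupp.single j 1) (Φ i))) ∧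
        NewtonNonDegenerate (subst Φ b)) →
      ∃ n, WinsIn (m := m) GermIsNC n b

/-! ## (a) Hironaka's polyhedra game, `c = 0` version -/

/-! ## (a) The cloud game: finite-depth winnability and the UNIFORM round bound (proved from the tree's potential) -/

namespace CloudGame

/-- `CloudWins N v`: from the exponent cloud `v` (rows = points, columns = slots) the mover reaches a CHAIN (no incomparable pair) within
`N` rounds, whatever live slot `l`, translated set `Z ⊆ J ∖ {l}` and re-indexing `σ` of the slots the opponent's answer produces; the
mover's centre `J` only uses slots on which the cloud is not identically zero (so that `J ⊆ T` in a toric state). -/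
def CloudWins {S : Type} [Fintype S] {n : ℕ} : ℕ → (S → Fin n → ℕ) → Prop
  | 0, v => MonomialCloud.incPairs v = ∅
  | N + 1, v => CloudWins N v ∨ ∃ J : Finset (Fin n), J.Nonempty ∧ (∀ t ∈ J, ∃ a, v a t ≠ 0) ∧
      ∀ l ∈ J, ∀ Z ⊆ J.erase l, ∀ σ : Fin n ≃ Fin n, CloudWins N (fun a => MonomialCloud.succ J l Z 0 (v a) ∘ σ)

/-- Unfolding at `0`. -/
theorem cloudWins_zero {S : Type} [Fintype S] {n : ℕ} (v : S → Fin n → ℕ) :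
    CloudWins 0 v ↔ MonomialCloud.incPairs v = ∅ := Iff.rfl

/-- Monotonicity in the budget. -/
theorem CloudWins.mono {S : Type} [Fintype S] {n : ℕ} {N N' : ℕ} (h : N ≤ N') {v : S → Fin n → ℕ} (hv : CloudWins N v) :
    CloudWins N' v := by
  induction N' generalizing N v with
  | zero =>
    obtain rfl := Nat.le_zero.mp h
    exact hv
  | succ N' ih =>
    rcases Nat.of_le_succ h with h' | rfl
    · exact Or.inl (ih h' hv)
    · exact hv

/-- **THE UNIFORM ROUND BOUND** (Hironaka's polyhedra game with translated answers, won): every cloud is won in some finite number of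
rounds, uniformly over the opponent's answers.  Proof: well-founded induction on the tree's potential `MonomialCloud.mu`; at a
non-chain cloud play the Perron move of `MonomialCloud.mu_succ_lt_of_incPairs` restricted to the cloud's non-zero slots, and take the
maximum of the budgets of the finitely many successors. -/
theorem exists_cloudWins {S : Type} [Fintype S] {n : ℕ} (v : S → Fin n → ℕ) : ∃ N, CloudWins N v := by
  classical
  suffices h : ∀ (o : Ordinal.{0}) (v : S → Fin n → ℕ), MonomialCloud.mu v = o → ∃ N, CloudWins N v from h _ v rfl
  intro o
  refine WellFoundedLT.induction
    (motive := fun o : Ordinal.{0} => ∀ v : S → Fin n → ℕ, MonomialCloud.mu v = o → ∃ N, CloudWins N v) o ?_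
  intro o ih v hv
  by_cases hinc : (MonomialCloud.incPairs v).Nonempty
  · obtain ⟨J₀, hJ₀, hstep⟩ := MonomialCloud.mu_succ_lt_of_incPairs hinc
    -- restrict the centre to the slots on which the cloud is not identically zero
    set J : Finset (Fin n) := J₀.filter (fun t => ∃ a, v a t ≠ 0) with hJdef
    have hJsub : J ⊆ J₀ := Finset.filter_subset _ _
    have hzero : ∀ t ∈ J₀, t ∉ J → ∀ a, v a t = 0 := by
      intro t ht htJ a
      by_contra hne
      exact htJ (Finset.mem_filter.mpr ⟨ht, a, hne⟩)
    have hsum : ∀ a, ∑ i' ∈ J, v a i' = ∑ i' ∈ J₀, v a i' := by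
      intro a
      rw [hJdef]
      exact Finset.sum_filter_of_ne (fun t _ hne => ⟨a, hne⟩)
    have hsucc : ∀ l (Z : Finset (Fin n)) a, MonomialCloud.succ J l Z 0 (v a) = MonomialCloud.succ J₀ l Z 0 (v a) := by
      intro l Z a
      funext i
      unfold MonomialCloud.succ
      rw [hsum a]
    have hJne : J.Nonempty := by
      by_contra hJe
      rw [Finset.not_nonempty_iff_eq_empty] at hJe
      obtain ⟨l, hl⟩ := hJ₀
      have hfix : (fun a => MonomialCloud.succ J₀ l ∅ 0 (v a)) = v := by
        funext a i
        have hall : ∀ t ∈ J₀, v a t = 0 := fun t ht => hzero t ht (by rw [hJe]; exact Finset.notMem_empty t) a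
        unfold MonomialCloud.succ
        by_cases h1 : i = l
        · rw [if_pos h1, h1, Finset.sum_eq_zero hall, hall l hl, Nat.sub_zero]
        · rw [if_neg h1, if_neg (Finset.notMem_empty i)]
      have hlt := hstep l hl ∅ (Finset.empty_subset _) 0 (fun j => Nat.zero_le _)
      rw [hfix] at hlt
      exact lt_irrefl _ hlt
    have hex : ∀ l ∈ J, ∀ Z ⊆ J.erase l, ∀ σ : Fin n ≃ Fin n,
        ∃ N, CloudWins N (fun a => MonomialCloud.succ J l Z 0 (v a) ∘ σ) := by
      intro l hl Z hZ σ
      refine ih _ ?_ _ rfl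
      have hZ₀ : Z ⊆ J₀.erase l := hZ.trans (Finset.erase_subset_erase l hJsub)
      have hlt := hstep l (hJsub hl) Z hZ₀ 0 (fun j => Nat.zero_le _)
      have hfun : (fun a => MonomialCloud.succ J l Z 0 (v a)) = fun a => MonomialCloud.succ J₀ l Z 0 (v a) :=
        funext fun a => hsucc l Z a
      calc MonomialCloud.mu (fun a => MonomialCloud.succ J l Z 0 (v a) ∘ σ)
          = MonomialCloud.mu (fun a => MonomialCloud.succ J l Z 0 (v a)) := MonomialCloud.mu_comp_equiv σ _
        _ = MonomialCloud.mu (fun a => MonomialCloud.succ J₀ l Z 0 (v a)) := by rw [hfun]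
        _ < MonomialCloud.mu v := hlt
        _ = o := hv
    choose! f hf using hex
    refine ⟨J.sup (fun l => (J.erase l).powerset.sup fun Z => Finset.univ.sup (f l Z)) + 1,
      Or.inr ⟨J, hJne, fun t ht => (Finset.mem_filter.mp ht).2, fun l hl Z hZ σ => ?_⟩⟩
    refine CloudWins.mono ?_ (hf l hl Z hZ σ)
    calc f l Z σ ≤ Finset.univ.sup (f l Z) := Finset.le_sup (f := f l Z) (Finset.mem_univ σ)
      _ ≤ (J.erase l).powerset.sup (fun Z => Finset.univ.sup (f l Z)) :=
          Finset.le_sup (f := fun Z => Finset.univ.sup (f l Z)) (Finset.mem_powerset.mpr hZ)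
      _ ≤ J.sup (fun l => (J.erase l).powerset.sup fun Z => Finset.univ.sup (f l Z)) :=
          Finset.le_sup (f := fun l => (J.erase l).powerset.sup fun Z => Finset.univ.sup (f l Z)) hl
  · rw [Finset.not_nonempty_iff_eq_empty] at hinc
    exact ⟨0, hinc⟩

end CloudGame

/-! ## (b) Toric states of the count game -/

/-- A TORIC STATE of the position `B` relative to the original germ `b` (both in `m + 1` variables): toric slots `T`, exponent matrix
`cols` (row `t` = current slot, column `i` = original variable; zero rows off `T`, no zero column), unit factors `u`, the invertible
LOG-JACOBIAN MATRIX (toric rows: exponents; log rows: `∂_t log uᵢ (0)`), and the bookkeeping `B = v·X^c·h`, `b∘x = X^d·h` for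
`xᵢ = (∏_t X_t^{cols t i})·uᵢ`, with `c`, `d` supported on `T`. -/
structure ToricState {m : ℕ} (b B : MvPowerSeries (Fin (m + 1)) k) where
  /-- the toric slots -/
  T : Finset (Fin (m + 1))
  /-- `cols t i` = exponent of the current slot `t` in the original variable `xᵢ` -/
  cols : Fin (m + 1) → Fin (m + 1) → ℕ
  cols_zero : ∀ t, t ∉ T → ∀ i, cols t i = 0
  col_pos : ∀ i, ∃ t ∈ T, 0 < cols t i
  /-- the unit factors -/
  u : Fin (m + 1) → MvPowerSeries (Fin (m + 1)) k
  u_unit : ∀ i, constantCoeff (u i) ≠ 0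
  /-- the log-Jacobian matrix is invertible -/
  logJac : IsUnit (Matrix.det (Matrix.of fun t i : Fin (m + 1) =>
    if t ∈ T then ((cols t i : ℕ) : k) else coeff (Finsupp.single t 1) (u i) * (constantCoeff (u i))⁻¹))
  /-- reduced transform, the position's unit, the two monomials -/
  h : MvPowerSeries (Fin (m + 1)) k
  v : MvPowerSeries (Fin (m + 1)) k
  v_unit : constantCoeff v ≠ 0
  c : Fin (m + 1) → ℕ
  d : Fin (m + 1) → ℕ
  c_zero : ∀ t, t ∉ T → c t = 0
  d_zero : ∀ t, t ∉ T → d t = 0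
  pos_eq : B = v * (∏ t, X t ^ c t) * h
  total_eq : subst (fun i => (∏ t, X t ^ cols t i) * u i) b = (∏ t, X t ^ d t) * h

/-- The CLOUD of a toric state on a finite set of exponents `S₀`: the row vectors `t ↦ ⟨cols t, a⟩`, `a ∈ S₀`. -/
def ToricState.cloud {m : ℕ} {b B : MvPowerSeries (Fin (m + 1)) k} (st : ToricState b B) (S₀ : Finset (Fin (m + 1) →₀ ℕ)) :
    ↥S₀ → Fin (m + 1) → ℕ :=
  fun a t => ∑ i, st.cols t i * (a : Fin (m + 1) →₀ ℕ) i

/-- `S₀` is a finite set of exponents of `b` below every exponent of `b` (e.g. the minimal ones). -/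
def Covers {m : ℕ} (b : MvPowerSeries (Fin (m + 1)) k) (S₀ : Finset (Fin (m + 1) →₀ ℕ)) : Prop :=
  (∀ a ∈ S₀, coeff a b ≠ 0) ∧ ∀ β, coeff β b ≠ 0 → ∃ a ∈ S₀, a ≤ β

/-- DICKSON: a non-zero germ has a non-empty covering set of exponents (its minimal exponents). -/
theorem exists_covers {m : ℕ} {b : MvPowerSeries (Fin (m + 1)) k} (hb : b ≠ 0) : ∃ S₀, Covers b S₀ ∧ S₀.Nonempty := by
  classical
  set supp : Set (Fin (m + 1) →₀ ℕ) := {β | coeff β b ≠ 0} with hsupp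
  have hfin : {a | Minimal (· ∈ supp) a}.Finite :=
    WellQuasiOrderedLE.finite_of_isAntichain (setOf_minimal_antichain (· ∈ supp))
  have hmem : ∀ a, a ∈ hfin.toFinset ↔ Minimal (· ∈ supp) a := fun a => Set.Finite.mem_toFinset hfin
  refine ⟨hfin.toFinset, ⟨fun a ha => ((hmem a).mp ha).prop, fun β hβ => ?_⟩, ?_⟩
  · obtain ⟨a, hab, hmin⟩ := (Set.isPWO_of_wellQuasiOrderedLE supp).exists_le_minimal (show β ∈ supp from hβ)
    exact ⟨a, (hmem a).mpr hmin, hab⟩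
  · have hex : ∃ β, coeff β b ≠ 0 := by
      by_contra hall
      exact hb (MvPowerSeries.ext fun β => by
        rw [MvPowerSeries.coeff_zero]; exact not_not.mp (not_exists.mp hall β))
    obtain ⟨β, hβ⟩ := hex
    obtain ⟨a, -, hmin⟩ := (Set.isPWO_of_wellQuasiOrderedLE supp).exists_le_minimal (show β ∈ supp from hβ)
    exact ⟨a, (hmem a).mpr hmin⟩

/-- `∏_t X_t^{[t = i]} = X_i`. -/
theorem prod_X_pow_ite_eq {m : ℕ} (i : Fin (m + 1)) :
    (∏ t : Fin (m + 1), (X t : MvPowerSeries (Fin (m + 1)) k) ^ (if t = i then 1 else 0)) = X i := by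
  rw [Finset.prod_eq_single i (fun t _ ht => by rw [if_neg ht, pow_zero]) (fun h => absurd (Finset.mem_univ i) h),
    if_pos rfl, pow_one]

/-- The INITIAL toric state: all slots toric, `cols = 1`, `u = 1`, `h = b`. -/
noncomputable def ToricState.init {m : ℕ} (b : MvPowerSeries (Fin (m + 1)) k) : ToricState b b where
  T := Finset.univ
  cols := fun t i => if t = i then 1 else 0
  cols_zero := fun t ht => absurd (Finset.mem_univ t) ht
  col_pos := fun i => ⟨i, Finset.mem_univ i, by simp⟩
  u := fun _ => 1
  u_unit := fun i => by simp
  logJac := by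
    have h1 : (Matrix.of fun t i : Fin (m + 1) =>
        if t ∈ (Finset.univ : Finset (Fin (m + 1))) then (((if t = i then 1 else 0 : ℕ)) : k)
        else coeff (Finsupp.single t 1) ((fun _ : Fin (m + 1) => (1 : MvPowerSeries (Fin (m + 1)) k)) i) *
          (constantCoeff ((fun _ : Fin (m + 1) => (1 : MvPowerSeries (Fin (m + 1)) k)) i))⁻¹) = 1 := by
      ext t i
      simp [Matrix.one_apply]
    rw [h1, Matrix.det_one]
    exact isUnit_one
  h := b
  v := 1
  v_unit := by simp
  c := 0
  d := 0
  c_zero := fun _ _ => rfl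
  d_zero := fun _ _ => rfl
  pos_eq := by simp
  total_eq := by
    have hx : (fun i => (∏ t : Fin (m + 1), (X t : MvPowerSeries (Fin (m + 1)) k) ^ (if t = i then 1 else 0)) * 1) = X := by
      funext i
      rw [mul_one, prod_X_pow_ite_eq]
    rw [hx, subst_self]
    simp

/-- (b) TORIC STEP (statement; chart calculus + log-Jacobian row reduction): blowing up the toric centre `{X_j = 0 : j ∈ J}`, `J ⊆ T`,
is a legal move whose every successor position admits a toric state with cloud `succ J l Z 0 ∘ σ` of the old cloud (`l` the live slot,
`Z` the translated slots, `σ` the re-indexing of the slice). -/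
def ToricStep (m : ℕ) : Prop :=
  ∀ (k : Type) [Field k] (b B : MvPowerSeries (Fin (m + 1)) k) (st : ToricState b B) (S₀ : Finset (Fin (m + 1) →₀ ℕ))
    (J : Finset (Fin (m + 1))), J.Nonempty → J ⊆ st.T →
    MoveClause B (fun i => X i) (fun i => if i ∈ J then 1 else 0)
      (fun B' => ∃ (st' : ToricState b B') (l : Fin (m + 1)) (Z : Finset (Fin (m + 1))) (σ : Fin (m + 1) ≃ Fin (m + 1)),
        l ∈ J ∧ Z ⊆ J.erase l ∧ st'.cloud S₀ = fun a => MonomialCloud.succ J l Z 0 (st.cloud S₀ a) ∘ σ)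

/-- (c) TORIC END (statement; the ND face lemma): at a chain state of a covering cloud, Newton non-degeneracy of the ORIGINAL germ makes
the position a normal crossing. -/
def ToricEnd (m : ℕ) : Prop :=
  ∀ (k : Type) [Field k] (b B : MvPowerSeries (Fin (m + 1)) k) (st : ToricState b B) (S₀ : Finset (Fin (m + 1) →₀ ℕ)),
    Covers b S₀ → S₀.Nonempty → MonomialCloud.incPairs (st.cloud S₀) = ∅ → NewtonNonDegenerate b → GermIsNC B

/-! ## (d) The assembly (proved) -/

/-- The identity coordinate change with the indicator weight of a non-empty `J` is a legal move. -/
theorem isCountMove_X_indicator {m : ℕ} {J : Finset (Fin (m + 1))} (hJ : J.Nonempty) :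
    IsCountMove (fun i => (X i : MvPowerSeries (Fin (m + 1)) k)) (fun i => if i ∈ J then 1 else 0) := by
  classical
  refine ⟨fun i => constantCoeff_X i, ?_, fun i => by show (if i ∈ J then 1 else 0) ≤ 1; split_ifs <;> simp, ?_⟩
  · have h1 : (Matrix.of fun i j : Fin (m + 1) => coeff (Finsupp.single j 1) (X i : MvPowerSeries (Fin (m + 1)) k)) = 1 := by
      ext i j
      simp [Matrix.one_apply, coeff_X, Finsupp.single_left_inj one_ne_zero, eq_comm]
    rw [h1, Matrix.det_one]
    exact isUnit_one
  · obtain ⟨i, hi⟩ := hJ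
    exact ⟨i, by simp [hi]⟩

/-- From a toric state whose cloud is won in `N` rounds, the mover wins the count game in `N` rounds. -/
theorem winsIn_of_cloudWins {m : ℕ} (hstep : ToricStep m) (hend : ToricEnd m) {b : MvPowerSeries (Fin (m + 1)) k}
    (hND : NewtonNonDegenerate b) {S₀ : Finset (Fin (m + 1) →₀ ℕ)} (hcov : Covers b S₀) (hne : S₀.Nonempty) :
    ∀ (N : ℕ) (B : MvPowerSeries (Fin (m + 1)) k) (st : ToricState b B),
      CloudGame.CloudWins N (st.cloud S₀) → WinsIn (m := m) GermIsNC N B := by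
  intro N
  induction N with
  | zero =>
    intro B st hw
    exact hend k b B st S₀ hcov hne hw hND
  | succ N ih =>
    intro B st hw
    rcases hw with hw | ⟨J, hJne, hJsupp, hmoves⟩
    · exact Or.inl (ih B st hw)
    · have hJT : J ⊆ st.T := by
        intro t ht
        obtain ⟨a, ha⟩ := hJsupp t ht
        by_contra htT
        apply ha
        show ∑ i, st.cols t i * (a : Fin (m + 1) →₀ ℕ) i = 0
        exact Finset.sum_eq_zero fun i _ => by rw [st.cols_zero t htT i, zero_mul]
      refine Or.inr ⟨fun i => X i, fun i => if i ∈ J then 1 else 0, isCountMove_X_indicator hJne, ?_⟩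
      refine (hstep k b B st S₀ J hJne hJT).mono ?_
      rintro B' ⟨st', l, Z, σ, hl, hZ, hcloud⟩
      exact ih B' st' (hcloud ▸ hmoves l hl Z hZ σ)

/-- **R6 ASSEMBLY.**  The toric step and the toric end lemma give the rung, in every dimension and characteristic. -/
theorem totRungNonDegenerate_of_toric (m : ℕ) (hstep : ToricStep m) (hend : ToricEnd m) : TOTRungNonDegenerate m := by
  intro p _ k _ _ _ b hb hND
  obtain ⟨S₀, hcov, hne⟩ := exists_covers hb
  obtain ⟨N, hN⟩ := CloudGame.exists_cloudWins ((ToricState.init b).cloud S₀)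
  exact ⟨N, winsIn_of_cloudWins hstep hend hND hcov hne N b (ToricState.init b) hN⟩

/-! ## Sanity checks -/

/-- Sanity: a monomial is torus-smooth (`x₀² ∈ (x₀², …)`). -/
example : TorusSmooth (X 0 ^ 2 : MvPowerSeries (Fin 1) k) := by
  refine ⟨2, ?_⟩
  have : (∏ i : Fin 1, (X i : MvPowerSeries (Fin 1) k)) ^ 2 = X 0 ^ 2 := by simp
  rw [this]
  exact Ideal.subset_span (Set.mem_insert _ _)

/-- Sanity: the Euler operator on a monomial coefficient. -/
example (b : MvPowerSeries (Fin 2) k) (α : Fin 2 →₀ ℕ) : eulerOp 0 b α = ((α 0 : ℕ) : k) * coeff α b := rfl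

/-- Sanity: a one-point cloud is a chain, won in `0` rounds. -/
example (e : Fin 3 → ℕ) : CloudGame.CloudWins 0 (fun _ : Unit => e) := by
  rw [CloudGame.cloudWins_zero, ← Finset.not_nonempty_iff_eq_empty]
  rintro ⟨p, hp⟩
  rw [MonomialCloud.mem_incPairs] at hp
  exact (lt_irrefl 0) (by simpa [MonomialCloud.posExcess] using hp.1)

end NCTransport

end Summit.ResolutionOfSingularities.ResolutionOfSingularities.Theorems
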